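import Summits.QuantumFields.YangMills.Theorems.UnitScaleTiltFlatPortAllSizes
import Summits.QuantumFields.YangMills.Theorems.UnitScaleTiltProp8FlatPortGBandUAllL
import Summits.QuantumFields.YangMills.Theorems.UnitScaleTiltProp8FlatPortBodyAllL
import Summits.QuantumFields.YangMills.Theorems.UnitScaleTiltProp8FlatPortCurlCurlSupRowAllL
import Summits.QuantumFields.YangMills.Theorems.UnitScaleTiltProp8FlatPortCurlCurlSupRowSharpAllL
import HarnessLib

/-!
# Route `UnitScaleTilt`, crux K1 child «MinimiserStabilityRegPr» (stmt-QuantumFields-19200), registered stub `stub_halvingStep` (H), branch (P2-small) ×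
# L-FLOOR LEDGER LF-1H (OWNER RULING g26-№18 ∕ №21 (3) ∕ №22: **α8 = the `hℓ : 4 ≤ ℓ` deletion down the H port chain**) — file **`FlatPortAllSizesAllL`**:
# **THE P2 PORTS AT EVERY TORUS SIZE FOR EVERY ODD `L ≥ 3`** — ✓`FlatPortAllSizes.body_of_adm22_allSizes` (P-1), `hSupFlatH_of_adm22_allSizes` (P-1′),
# `gBand_of_adm22_allSizes` (P-2), `curlCurlSupRow_of_adm22_allSizes` (P-3), `curlCurlSupRowSharp_of_adm22_allSizes` (P-3♯) VERBATIM with the binder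
# `(hℓ : 4 ≤ ℓ)` DELETED: the upstairs suppliers are ym-inputs-p09's ✓`FlatPortBodyAllL.body_of_adm22_allL`∕`rowsAt_of_adm22_allL`,
# ✓`FlatPortCurlCurlSupRowAllL.curlCurlSupRow_of_adm22_allL`, ✓`FlatPortCurlCurlSupRowSharpAllL.curlCurlSupRowSharp_of_adm22_allL` and this seat's explicit-weight
# ✓`FlatPortGBandUAllL.gBandU_of_adm22_allL`; the descents are ✓`FlatPortAllSizes` §1 (`body_of_cover`, `hSupFlatH_of_cover`, `gBand_of_cover`, `curlCurlSup_of_cover`,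
# `curlCurlSupSharp_of_cover`) and the size bookkeeping `liftData`, all `L`-floor-free.

Cell `ym3-torus` (HUMAN RULING D-0037, YM ladder rung R3 — continuum SU(2) YM₃ on the torus is a RUNG, not the Clay problem), explicit-unit helper seat
`ym-ust-19200-w7` gen 0.  `--supports stmt-QuantumFields-19200 --as helper`; count-neutral; def-free, 0 sorry, standard axioms.  HONEST SCOPE: after this file the P2
side of the H pillar reads at every odd `L ≥ 3` and every torus size; the H stub, the crux, the rung and the mass gap are NOT touched.

References: T. Bałaban, CMP **102** (1985) 277–309 [Balaban1985Variational] (45)–(46) p.285, (143)–(144) p.300, (157)–(158) p.302, (161)–(163) p.303, (165) p.304;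
CMP **96** (1984) 223–250 [Balaban1984PropagatorsII] (2.1)–(2.3) p.224, (2.16) p.225, Prop. 2.6 (2.136) p.247, Prop. 2.7 (2.149) p.249, Cor. 2.8 (2.150)–(2.151) p.249.
-/

set_option autoImplicit false

noncomputable section

open scoped BigOperators

namespace Summit.QuantumFields.YangMills.Theorems.FlatPortAllSizesAllL

open Literature.MathematicalPhysics.QuantumFieldTheory.Balaban1983to89
open B6GlobalChartV1 (PV)
open B6SectADomainsV1 (Domains)
open B6SectAOperatorsV1 (BondIdx dcE dcsE)
open T3ContinuumYM3Torus (T3Family)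
open FlatCubeOpsText (Adm22 IsLevWeight distBI IsFlatH IsFlatGt HSupLetterG GtSupLetterG GtLaplaceLetterG HDecayLetterD RowSum162)
open FlatOpsLettersAssembly (flatH IsFlatGW hSupLetterG_mono gtSupLetterG_mono gtLaplaceLetterG_mono hDecayLetterD_mono)
open CoverSites (projBond)
open CoverDomains (isLevWeight_comap)
open FlatPortAllSizes (body_of_cover hSupFlatH_of_cover gBand_of_cover curlCurlSup_of_cover curlCurlSupSharp_of_cover liftData)
open FlatPortBodyAllL (body_of_adm22_allL rowsAt_of_adm22_allL)
open FlatPortGBandUAllL (gBandU_of_adm22_allL)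
open FlatPortCurlCurlSupRowAllL (curlCurlSupRow_of_adm22_allL)
open FlatPortCurlCurlSupRowSharpAllL (curlCurlSupRowSharp_of_adm22_allL)

/-- `1 ≤ 3` (named once). [folklore] -/
private theorem hd3 : 1 ≤ 2 + 1 := by norm_num

/-- ★ **(P-1) AT EVERY TORUS SIZE AND EVERY ODD `L ≥ 3` — THE BODY OF THE REGISTERED P2 TEXT AT EVERY ADMISSIBLE DATUM, NO `a′ + 3 ≤ m + n`**: ✓`FlatPortBodyL0.body_of_adm22` verbatim with that binder
deleted (constant `max B₀ 0 · (L^{M_h⁰+2})³`); small members are read on their cover (`liftData` + the L0 port upstairs + `body_of_cover`).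
[cite: Balaban1985Variational, (46) p.285, (144) p.300, (157)-(158) p.302, (161)-(163) p.303, (165) p.304; Balaban1984PropagatorsII, (2.1)-(2.3) p.224, Prop. 2.6 (2.136) p.247, Cor. 2.8 p.249] -/
theorem body_of_adm22_allSizes_allL (ℓ : ℕ) (hL : Odd (ℓ + 1) ∧ 1 < ℓ + 1) :
    ∃ (Mh₀ R₀ : ℕ) (B₀ δ₀ B₃ : ℝ), 0 < δ₀ ∧ 0 < B₃ ∧
    ∀ (m : ℕ) (hm : 1 ≤ m) (n K : ℕ) (_ : 1 ≤ K - n) (_ : K - n + 1 ≤ m + K) {Mh R a' : ℕ} (_ : Mh = (ℓ + 1) ^ a') (_ : Mh₀ ≤ Mh) (_ : R₀ ≤ R)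
      (D : Domains (PV 2 ℓ m K hd3 hL)) (_ : D.k = K - n) (_ : Adm22 D R ((ℓ + 1) * Mh))
      (w : ℕ → PBond (PV 2 ℓ m K hd3 hL) 0 → ℝ) (_ : IsLevWeight (⟨ℓ + 1, hL, m, hm⟩ : T3Family) n K D w),
      ∃ (H : (BondIdx D → ℝ) →ₗ[ℝ] (PBond (PV 2 ℓ m K hd3 hL) 0 → ℝ)) (Gt : (PBond (PV 2 ℓ m K hd3 hL) 0 → ℝ) →ₗ[ℝ] (PBond (PV 2 ℓ m K hd3 hL) 0 → ℝ)),
        IsFlatH (⟨ℓ + 1, hL, m, hm⟩ : T3Family) n K D H ∧ IsFlatGt (⟨ℓ + 1, hL, m, hm⟩ : T3Family) n K D Gt ∧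
        HSupLetterG (⟨ℓ + 1, hL, m, hm⟩ : T3Family) n K D w H B₀ ∧ GtSupLetterG (⟨ℓ + 1, hL, m, hm⟩ : T3Family) n K w Gt B₀ ∧
          GtLaplaceLetterG (⟨ℓ + 1, hL, m, hm⟩ : T3Family) n K w Gt B₀ ∧
        ∃ dBI : PBond (PV 2 ℓ m K hd3 hL) 0 → BondIdx D → ℝ,
          (∀ b c, distBI D b c ≤ dBI b c) ∧ RowSum162 (⟨ℓ + 1, hL, m, hm⟩ : T3Family) n K D dBI w δ₀ B₃ ∧
            HDecayLetterD (⟨ℓ + 1, hL, m, hm⟩ : T3Family) n K D dBI w H B₀ δ₀ := by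
  obtain ⟨Mh₀, R₀, B₀, δ₀, B₃, hδ₀, hB₃, hmain⟩ := body_of_adm22_allL ℓ hL
  refine ⟨Mh₀, R₀, max B₀ 0 * ((((ℓ + 1) ^ (Mh₀ + 2)) ^ 3 : ℕ) : ℝ), δ₀, B₃, hδ₀, hB₃, ?_⟩
  intro m hm n K hk1 hk' Mh R a' hMha hMh hR D hDk hAdm w hw
  obtain ⟨a'', hMh'', hsize'', hAdm''⟩ := liftData ℓ hL Mh₀ (n := n) hm hMha hMh D hAdm
  obtain ⟨Ht, Gtt, hFHt, hFGt, h1, h2, h3, dBIt, hdom, h4, h5⟩ :=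
    hmain (m + (Mh₀ + 2)) (by omega) n K hk1 (by omega) rfl hMh'' hR hsize'' (D.comap (Mh₀ + 2)) hDk hAdm''
      (fun k bt => w k (projBond (PV 2 ℓ m K hd3 hL) (Mh₀ + 2) 0 bt)) (isLevWeight_comap (⟨ℓ + 1, hL, m, hm⟩ : T3Family) n K (Mh₀ + 2) D hw)
  exact body_of_cover (⟨ℓ + 1, hL, m, hm⟩ : T3Family) n K (Mh₀ + 2) D hw (le_max_right B₀ 0) hδ₀.le
    ⟨Ht, Gtt, hFHt, hFGt, hSupLetterG_mono h1 (le_max_left _ _), gtSupLetterG_mono h2 (le_max_left _ _), gtLaplaceLetterG_mono h3 (le_max_left _ _),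
      dBIt, hdom, h4, hDecayLetterD_mono h5 (le_max_left _ _)⟩

/-- ★ **(P-1′) AT EVERY TORUS SIZE AND EVERY ODD `L ≥ 3` — THE (46) SUP ROW OF THE CANONICAL `flatH`, SAME CONSTANT `max C (C·B₃)`**: exactly the `.1.1` entry of ✓`FlatPortBodyL0.rowsAt_of_adm22` that
`…HalvingDressingLetterFlat`∕`…FlatScaled`∕`…ChartOfRecord` read, with the binder `a′ + 3 ≤ m + n` deleted (★★★`flatH_cover`).
[cite: Balaban1985Variational, (46) p.285, (144) p.300, (157) p.302; Balaban1984PropagatorsII, (2.1)-(2.3) p.224, Cor. 2.8 (2.150)-(2.151) p.249] -/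
theorem hSupFlatH_of_adm22_allSizes_allL (ℓ : ℕ) (hL : Odd (ℓ + 1) ∧ 1 < ℓ + 1) :
    ∃ (Mh₀ R₀ : ℕ) (C : ℝ), 0 ≤ C ∧
    ∀ (m : ℕ) (hm : 1 ≤ m) (n K : ℕ) (_ : 1 ≤ K - n) (_ : K - n + 1 ≤ m + K) {Mh R a' : ℕ} (_ : Mh = (ℓ + 1) ^ a') (_ : Mh₀ ≤ Mh) (_ : R₀ ≤ R)
      (D : Domains (PV 2 ℓ m K hd3 hL)) (_ : D.k = K - n) (_ : Adm22 D R ((ℓ + 1) * Mh))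
      (w : ℕ → PBond (PV 2 ℓ m K hd3 hL) 0 → ℝ) (_ : IsLevWeight (⟨ℓ + 1, hL, m, hm⟩ : T3Family) n K D w),
      HSupLetterG (⟨ℓ + 1, hL, m, hm⟩ : T3Family) n K D w (flatH (⟨ℓ + 1, hL, m, hm⟩ : T3Family) n K D) C := by
  obtain ⟨Mh₀, R₀, C, δ₀, B₃, CG, hC, -, -, -, hmain⟩ := rowsAt_of_adm22_allL ℓ hL
  refine ⟨Mh₀, R₀, max C (C * B₃), le_max_of_le_left hC, ?_⟩
  intro m hm n K hk1 hk' Mh R a' hMha hMh hR D hDk hAdm w hw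
  obtain ⟨a'', hMh'', hsize'', hAdm''⟩ := liftData ℓ hL Mh₀ (n := n) hm hMha hMh D hAdm
  have hup := hmain (m + (Mh₀ + 2)) (by omega) n K hk1 (by omega) rfl hMh'' hR hsize'' (D.comap (Mh₀ + 2)) hDk hAdm''
    (fun k bt => w k (projBond (PV 2 ℓ m K hd3 hL) (Mh₀ + 2) 0 bt)) (isLevWeight_comap (⟨ℓ + 1, hL, m, hm⟩ : T3Family) n K (Mh₀ + 2) D hw)
  exact hSupFlatH_of_cover (⟨ℓ + 1, hL, m, hm⟩ : T3Family) n K (Mh₀ + 2) D hup.1.1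

/-- ★ **(P-2) AT EVERY TORUS SIZE AND EVERY ODD `L ≥ 3` — THE `G`-BAND PACKAGE, SAME `C_G`, NO `a′ + 3 ≤ m + n`**: ✓`FlatPortGBandL0.gBand_of_adm22` verbatim with that binder deleted (`gBandU_of_adm22`
upstairs + `gBand_of_cover`). [cite: Balaban1984PropagatorsII, (2.1)-(2.3) p.224, (2.16) p.225, Prop. 2.6 (2.136) p.247; Balaban1985Variational, (144) p.300, (165) p.304] -/
theorem gBand_of_adm22_allSizes_allL (ℓ : ℕ) (hL : Odd (ℓ + 1) ∧ 1 < ℓ + 1) :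
    ∃ (Mh₀ R₀ : ℕ) (CG : ℝ), 0 ≤ CG ∧
    ∀ (m : ℕ) (hm : 1 ≤ m) (n K : ℕ) (_ : 1 ≤ K - n) (_ : K - n + 1 ≤ m + K) {Mh R a' : ℕ} (_ : Mh = (ℓ + 1) ^ a') (_ : Mh₀ ≤ Mh) (_ : R₀ ≤ R)
      (D : Domains (PV 2 ℓ m K hd3 hL)) (_ : D.k = K - n) (_ : Adm22 D R ((ℓ + 1) * Mh))
      (w : ℕ → PBond (PV 2 ℓ m K hd3 hL) 0 → ℝ) (_ : IsLevWeight (⟨ℓ + 1, hL, m, hm⟩ : T3Family) n K D w),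
      ∃ (w' : BondIdx D → ℝ) (hw' : ∀ i, 0 < w' i)
        (G : (PBond (PV 2 ℓ m K hd3 hL) 0 → ℝ) →ₗ[ℝ] (PBond (PV 2 ℓ m K hd3 hL) 0 → ℝ)),
        IsFlatGW (⟨ℓ + 1, hL, m, hm⟩ : T3Family) n K D hw' G ∧ GtSupLetterG (⟨ℓ + 1, hL, m, hm⟩ : T3Family) n K w G CG ∧
        ∀ c : BondIdx D, w' c ≤ ((((ℓ + 1 : ℕ) : ℝ)) ^ (K - n)) ^ 2 * (((ℓ + 1 : ℕ) : ℝ)) ^ (c.1.1 : ℕ) := by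
  obtain ⟨Mh₀, R₀, CG, hCG, hmain⟩ := gBandU_of_adm22_allL ℓ hL
  refine ⟨Mh₀, R₀, CG, hCG, ?_⟩
  intro m hm n K hk1 hk' Mh R a' hMha hMh hR D hDk hAdm w hw
  obtain ⟨a'', hMh'', hsize'', hAdm''⟩ := liftData ℓ hL Mh₀ (n := n) hm hMha hMh D hAdm
  obtain ⟨hwt, Gc, hGc, hGcs⟩ := hmain (m + (Mh₀ + 2)) (by omega) n K hk1 (by omega) rfl hMh'' hR hsize'' (D.comap (Mh₀ + 2)) hDk hAdm''
    (fun k bt => w k (projBond (PV 2 ℓ m K hd3 hL) (Mh₀ + 2) 0 bt)) (isLevWeight_comap (⟨ℓ + 1, hL, m, hm⟩ : T3Family) n K (Mh₀ + 2) D hw)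
  exact gBand_of_cover (⟨ℓ + 1, hL, m, hm⟩ : T3Family) n K (Mh₀ + 2) D ⟨hwt, Gc, hGc, hGcs⟩

/-- ★ **(P-3) AT EVERY TORUS SIZE AND EVERY ODD `L ≥ 3` — (X1), SAME `C_X`, NO `a′ + 3 ≤ m + n`**: ✓`FlatPortCurlCurlSupRowL0.curlCurlSupRow_of_adm22` verbatim with that binder deleted (the L0 port upstairs +
`curlCurlSup_of_cover`). [cite: Balaban1984PropagatorsII, (2.1)-(2.3) p.224, Prop. 2.7 (2.149) p.249; Balaban1985Variational, (45)-(46) p.285, (144) p.300] -/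
theorem curlCurlSupRow_of_adm22_allSizes_allL (ℓ : ℕ) (hL : Odd (ℓ + 1) ∧ 1 < ℓ + 1) :
    ∃ (Mh₀ R₀ : ℕ) (CX : ℝ), 0 ≤ CX ∧
    ∀ (m : ℕ) (hm : 1 ≤ m) (n K : ℕ) (_ : 1 ≤ K - n) (_ : K - n + 1 ≤ m + K) {Mh R a' : ℕ} (_ : Mh = (ℓ + 1) ^ a') (_ : Mh₀ ≤ Mh) (_ : R₀ ≤ R)
      (D : Domains (PV 2 ℓ m K hd3 hL)) (_ : D.k = K - n) (_ : Adm22 D R ((ℓ + 1) * Mh))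
      (w : ℕ → PBond (PV 2 ℓ m K hd3 hL) 0 → ℝ) (_ : IsLevWeight (⟨ℓ + 1, hL, m, hm⟩ : T3Family) n K D w),
      ∀ (X : BondIdx D → ℝ) (t : ℝ), 0 ≤ t → (∀ c, |X c| ≤ t) → ∀ b : PBond (PV 2 ℓ m K hd3 hL) 0,
        w 3 b * |(dcsE ((((ℓ + 1 : ℕ) : ℝ)) ^ (K - n)) (dcE ((((ℓ + 1 : ℕ) : ℝ)) ^ (K - n))
          (WithLp.toLp 2 (flatH (⟨ℓ + 1, hL, m, hm⟩ : T3Family) n K D X)))) b| ≤ CX * t := by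
  obtain ⟨Mh₀, R₀, CX, hCX, hmain⟩ := curlCurlSupRow_of_adm22_allL ℓ hL
  refine ⟨Mh₀, R₀, CX, hCX, ?_⟩
  intro m hm n K hk1 hk' Mh R a' hMha hMh hR D hDk hAdm w hw
  obtain ⟨a'', hMh'', hsize'', hAdm''⟩ := liftData ℓ hL Mh₀ (n := n) hm hMha hMh D hAdm
  have hup := hmain (m + (Mh₀ + 2)) (by omega) n K hk1 (by omega) rfl hMh'' hR hsize'' (D.comap (Mh₀ + 2)) hDk hAdm''
    (fun k bt => w k (projBond (PV 2 ℓ m K hd3 hL) (Mh₀ + 2) 0 bt)) (isLevWeight_comap (⟨ℓ + 1, hL, m, hm⟩ : T3Family) n K (Mh₀ + 2) D hw)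
  exact curlCurlSup_of_cover (⟨ℓ + 1, hL, m, hm⟩ : T3Family) n K (Mh₀ + 2) D hup

/-- ★ **(P-3♯) AT EVERY TORUS SIZE AND EVERY ODD `L ≥ 3` — (X1♯) AT LEVEL-WEIGHTED DATA, SAME `C♯`, NO `a′ + 3 ≤ m + n`**: ✓`FlatPortCurlCurlSupRowSharpL0.curlCurlSupRowSharp_of_adm22` verbatim with that
binder deleted (the L0 port upstairs + `curlCurlSupSharp_of_cover`). [cite: Balaban1984PropagatorsII, (2.1)-(2.3) p.224, Prop. 2.7 (2.149) p.249; Balaban1985Variational, (45)-(46) p.285, (144) p.300] -/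
theorem curlCurlSupRowSharp_of_adm22_allSizes_allL (ℓ : ℕ) (hL : Odd (ℓ + 1) ∧ 1 < ℓ + 1) :
    ∃ (Mh₀ R₀ : ℕ) (CX : ℝ), 0 ≤ CX ∧
    ∀ (m : ℕ) (hm : 1 ≤ m) (n K : ℕ) (_ : 1 ≤ K - n) (_ : K - n + 1 ≤ m + K) {Mh R a' : ℕ} (_ : Mh = (ℓ + 1) ^ a') (_ : Mh₀ ≤ Mh) (_ : R₀ ≤ R)
      (D : Domains (PV 2 ℓ m K hd3 hL)) (_ : D.k = K - n) (_ : Adm22 D R ((ℓ + 1) * Mh))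
      (w : ℕ → PBond (PV 2 ℓ m K hd3 hL) 0 → ℝ) (_ : IsLevWeight (⟨ℓ + 1, hL, m, hm⟩ : T3Family) n K D w),
      ∀ (X : BondIdx D → ℝ) (t : ℝ), 0 ≤ t → (∀ c, ((((ℓ + 1 : ℕ) : ℝ)) ^ ((c.1.1 : ℕ)) * ((((ℓ + 1 : ℕ) : ℝ))⁻¹) ^ (K - n)) * |X c| ≤ t) →
        ∀ b : PBond (PV 2 ℓ m K hd3 hL) 0,
          w 3 b * |(dcsE ((((ℓ + 1 : ℕ) : ℝ)) ^ (K - n)) (dcE ((((ℓ + 1 : ℕ) : ℝ)) ^ (K - n))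
            (WithLp.toLp 2 (flatH (⟨ℓ + 1, hL, m, hm⟩ : T3Family) n K D X)))) b| ≤ CX * t := by
  obtain ⟨Mh₀, R₀, CX, hCX, hmain⟩ := curlCurlSupRowSharp_of_adm22_allL ℓ hL
  refine ⟨Mh₀, R₀, CX, hCX, ?_⟩
  intro m hm n K hk1 hk' Mh R a' hMha hMh hR D hDk hAdm w hw
  obtain ⟨a'', hMh'', hsize'', hAdm''⟩ := liftData ℓ hL Mh₀ (n := n) hm hMha hMh D hAdm
  have hup := hmain (m + (Mh₀ + 2)) (by omega) n K hk1 (by omega) rfl hMh'' hR hsize'' (D.comap (Mh₀ + 2)) hDk hAdm''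
    (fun k bt => w k (projBond (PV 2 ℓ m K hd3 hL) (Mh₀ + 2) 0 bt)) (isLevWeight_comap (⟨ℓ + 1, hL, m, hm⟩ : T3Family) n K (Mh₀ + 2) D hw)
  exact curlCurlSupSharp_of_cover (⟨ℓ + 1, hL, m, hm⟩ : T3Family) n K (Mh₀ + 2) D hup

end Summit.QuantumFields.YangMills.Theorems.FlatPortAllSizesAllL

end
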